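import Mathlib
import HarnessLib
import Summits.HubbardSuperconductivity.HubbardSuperconductivity.Theorems.KLProgrammeKLRegimeEngineTowerLevLawBaseTokX
import Summits.HubbardSuperconductivity.HubbardSuperconductivity.Theorems.KLProgrammeKLRegimeEngineTowerLevLawOfRowsF

/-!
# Route `KLProgramme` — crux K3 ENGINE (stmt-HubbardSuperconductivity-20437 `KLRegimeEngineV17F2`), stub (b) v2, THE LEVELS PACKAGE (ℓ):
# «(ℓ)-READOUT-F», model layers M3/M4 WITH THE CHERNOFF DATA EXPORTED — the tokenised floor-keyed law (numerics closed / amplitudes by `B ≥ B₀`) whose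
# conclusion also RETURNS the per-block profile rows and the five smallness rows at the law's own `(A′, Q′, ι₃, λ)` (cell gate-hubbard-kl, seat hubbard-kl-k3c3-p2 g16;
# export twins of …TowerLevLawOfRowsFTok; the originals are untouched)

WHY.  See …TowerLevLawBaseTokX.  From this layer on the numerics are closed (`towerLevNumericsG_side_of_doors`), so the export also carries the five smallness
rows `4σλQ′ < 1`, `2λτQ′ ≤ 1`, `eτλQ′ < 1`, `y < 1`, `θ < 1` at `λ = B·ε_j` — with the profile rows these are ALL the hypotheses of E1's part 7
`towerReadoutIncrement_le` at `(A″, Q″) := (A′, Q′)`, so the read-out of any level inside any block needs no numerics of its own.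

* **`klTowerBLevF_le_law_lev_of_doors_tokX`** — twin of `…_of_doors_tok`; * **`klTowerBLevF_le_law_lev_of_doors_of_le_B_tokX`** — twin of `…_of_le_B_tok`.
Conclusions: `(∀ k, 1 ≤ k ≤ K_b → Zk k) ∧ (law) ∧ (∀ k, 1 ≤ k ≤ K_b → profile rows of block k) ∧ (x₁ ∧ x₂ ∧ x₃ ∧ y ∧ θ)`; the six-leg cell is asked up to
`k ≤ K_b` (the last block's read-out needs it).  Every other binder is byte-identical to the `_tok` original.
Compositions of landed theorems and real algebra; nothing about the model is asserted beyond them; nothing asserts (ℓ), any stub, K3 or superconductivity.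
References: BGM 2006 §2.8 (2.83), (2.93)–(2.98), Lemma 2.5 [cite: BenfattoGiulianiMastropietro2006].
-/


noncomputable section

namespace Summit.HubbardSuperconductivity.HubbardSuperconductivity.Theorems.EngineV8

set_option linter.dupNamespace false -- summit = problem name (single-conjunct summit), D-0017

open Classical
open Real Finset Literature.MathematicalPhysics.QuantumLattice Literature.Probability.LatticeModels GrassmannAlgebra
open Literature.MathematicalPhysics.QuantumLattice.FermiRG
open Summit.HubbardSuperconductivity.HubbardSuperconductivity.Theorems.KLProgrammeLegKernels
open Summit.HubbardSuperconductivity.HubbardSuperconductivity.Theorems.KLRegimeSplit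
open Summit.HubbardSuperconductivity.HubbardSuperconductivity.Theorems.KLRegimeWick
open Summit.HubbardSuperconductivity.HubbardSuperconductivity.Theorems.TorusFourierL2
open Summit.HubbardSuperconductivity.HubbardSuperconductivity.Theorems.DispersionFlow

variable {L M : ℕ} [NeZero L] [NeZero M]

/-! ## §1 M3: numerics closed, doors form, token carried, Chernoff data exported -/

/-- **THE FLOOR-KEYED LAW, NUMERICS CLOSED, DOORS FORM, TOKEN CARRIED, CHERNOFF DATA EXPORTED** («(ℓ)-READOUT-F» twin of
`klTowerBLevF_le_law_lev_of_doors_tok`: the cell is asked up to `k ≤ K_b`; the conclusion also RETURNS the measured profile rows of every block `1 ≤ k ≤ K_b` at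
`(A′, Q′, ι₃)` and the five smallness rows `x₁, x₂, x₃, y, θ` at `λ = B·ε_j` — exactly the inputs of E1's `towerReadoutIncrement_le` at the law's own constants).
[cite: BenfattoGiulianiMastropietro2006, §2.8 (2.83), (2.93)-(2.98)] -/
theorem klTowerBLevF_le_law_lev_of_doors_tokX :
    ∃ C₁ C₂ : ℝ, 0 < C₁ ∧ 0 < C₂ ∧ ∀ R : RenConsts, R.WF2 → ∃ c₃' : ℝ, 0 < c₃' ∧ ∃ U₀' : ℝ, 0 < U₀' ∧
      ∀ (P : SplitConsts) (c : ℝ), P.WF → 0 < c → c ≤ klEngC₃6 P R → c ≤ c₃' →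
      ∀ μ ∈ klWindowC, ∀ U : ℝ, 0 < U → U ≤ klEngU₀9 P R c → U ≤ U₀' → ∀ β : ℝ, klBetaMin ≤ β → β ≤ Real.exp (c / U ^ 2) →
      ∀ K : TrigPolyC4v, FrameOK R U (nScales β) μ K → ∀ (L M : ℕ) [NeZero L] [NeZero M],
      klEngL₃ β U ≤ L → klEngM₃ β U L ≤ M → ∀ d Kb D : ℕ, 2 ≤ d → d * Kb - 1 ≤ nScales β + 1 → 3 ≤ D →
      ∀ (cc : ℝ) (n j : ℕ), IsKLRegime U cc (-(n : ℤ)) → j ≤ n →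
      ∀ (B Ab Qb : ℝ), 0 < B → 0 < Ab → 0 ≤ Qb →
      -- the base datum at the family `F_{d−1}` and its unit law, at `λ = B·ε_j`
      ∀ Nb : Fin 5 → ℕ → ℝ, (∀ t p, 0 ≤ Nb t p) →
        (∀ (t : Fin 5) (p : ℕ) (Ωe' : Fin (2 * p) → Option (SectorLeg (sectorCount (d - 1)))), levelCount Ωe' = (t : ℕ) + 1 →
          klLevNormOf L M β μ K (d - 1) (2 * p) (klTowerInput L M β U μ K d 1) Ωe' ≤ Nb t p) →
        (∀ (t : Fin 5) (p : ℕ), 3 ≤ p → Nb t p / klLevUnitF β M t p (d - 1) ≤ Ab * (B * epsCoupling P U j) ^ (p - 1) * Qb ^ p) →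
      ∀ (W Z σ Φ ψ τ ι₁ ι₂ X : ℝ), 0 < W → 0 < Z → 0 ≤ σ → 0 ≤ Φ → 0 ≤ ψ → 0 < τ → 0 ≤ ι₁ → 0 ≤ ι₂ → 0 ≤ X →
      -- the explicit (I5)-F choices (equational binders)
      ∀ (ρ Q' Q κ Y A A' ι₃ : ℝ), ρ = max 4 (2 * τ * ψ) → Q' = Z * Qb + 1 → Q = ρ * Q' →
        κ = W * ((27 : ℝ) ^ 5 * (C₁ / C₂) * (8 : ℝ) ^ (d - 1)) →
        Y = ι₂ / (2 * Q') + W * Z ^ 3 * X / (4 * Q' ^ 2) + (W * (27 : ℝ) ^ 5 * Ab + κ * Ab) * Q' / 2 →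
        A = 2 * Y * (1 - ((2 : ℝ) ^ d)⁻¹) / (κ * Q') →
        A' = (W * (27 : ℝ) ^ 5 * Ab + κ * Ab) + 2 * Y / Q' → ι₃ = W * Z ^ 3 * X + A' * Q' ^ 3 →
      -- the BLOCKING row and the two AMPLITUDE rows
      max 1 Z * C₂ ^ 2 * max 4 (2 * τ * ψ) ≤ (2 : ℝ) ^ (d - 1) → 8 * Φ * τ * Y ≤ 1 →
        128 * exp 1 * ψ ^ 3 * τ ^ 4 * Φ * κ * Y ≤ (1 - ((2 : ℝ) ^ d)⁻¹) * ρ ^ 3 →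
      -- the imports (E1 (I4)) at `λ = B·ε_j`
      (∀ k, 1 ≤ k → k < Kb → W * Z ^ 1 * klTowerMuLevF L M β U μ K d k 1 ≤ ι₁ * (B * epsCoupling P U j)) →
      (∀ k, 1 ≤ k → k < Kb → W * Z ^ 2 * klTowerMuLevF L M β U μ K d k 2 ≤ ι₂ * (B * epsCoupling P U j)) →
      -- the located six-leg cell «(I2)-F1-HMU» at the blocks `k ≥ 2`
      (∀ k, 2 ≤ k → k ≤ Kb → klTowerMuLevAtF L M β U μ K d 0 k 3 ≤ X * (B * epsCoupling P U j) ^ 2) →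
      -- the token along the blocks («(ℓ)-Z-THREAD»): base, and propagation under the step's guard
      ∀ Zk : ℕ → Prop, Zk 1 →
      (∀ k, 1 ≤ k → k < Kb → Zk k → Φ * towerV D τ (fun m => W * Z ^ m * klTowerMuLevF L M β U μ K d k m) < 1 → Zk (k + 1)) →
      -- the floor step at blocks `k ≥ 1`, which may use the token at its own block
      (∀ t : Fin 5, ∀ k, 1 ≤ k → k < Kb → Zk k → ∀ N : ℕ, 2 ≤ N → ∀ p, 3 ≤ p → p ≤ D →
        Φ * towerV D τ (fun m => W * Z ^ m * klTowerMuLevF L M β U μ K d k m) < 1 →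
        klTowerBLevF L M β U μ K d t (k + 1) p ≤
          towerFO D σ (fun m => W * Z ^ m * klTowerMuLevF L M β U μ K d k m) p +
            ∑ n ∈ Icc 2 N, exp 1 * Φ ^ (n - 1) * ψ ^ p * towerS D τ (fun m => W * Z ^ m * klTowerMuLevF L M β U μ K d k m) n p +
            ψ ^ p * exp 1 * towerV D τ (fun m => W * Z ^ m * klTowerMuLevF L M β U μ K d k m) *
              (Φ * towerV D τ (fun m => W * Z ^ m * klTowerMuLevF L M β U μ K d k m)) ^ N /
              (1 - Φ * towerV D τ (fun m => W * Z ^ m * klTowerMuLevF L M β U μ K d k m))) →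
      -- the two doors
      U ≤ min 1 (min (1 / (8 * σ * Q' + 1)) (min (1 / (2 * exp 1 * τ * Q' + 1)) (min (1 / (4 * Φ * τ * ι₁ + 1))
        (min (1 / (2 * (Φ * (exp 1 * τ * ι₁ + (exp 1 * τ) ^ 2 * ι₂ + (exp 1 * τ) ^ 3 * ι₃ + A' * (exp 1 * τ * Q') ^ 2 / 2)) + 1))
          (min (A * Q ^ 3 / (16 * σ * Q' * A' * (4 * Q') ^ 3 + A * Q ^ 3))
            (A * Q ^ 3 / (16 * exp 1 * ψ * (2 * τ * ψ * Q') ^ 2 * Φ * τ ^ 2 * ι₁ ^ 2 + A * Q ^ 3))))))) / (2 * B * P.Klam + 1) →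
      cc ≤ min 1 (min (1 / (8 * σ * Q' + 1)) (min (1 / (2 * exp 1 * τ * Q' + 1)) (min (1 / (4 * Φ * τ * ι₁ + 1))
        (min (1 / (2 * (Φ * (exp 1 * τ * ι₁ + (exp 1 * τ) ^ 2 * ι₂ + (exp 1 * τ) ^ 3 * ι₃ + A' * (exp 1 * τ * Q') ^ 2 / 2)) + 1))
          (min (A * Q ^ 3 / (16 * σ * Q' * A' * (4 * Q') ^ 3 + A * Q ^ 3))
            (A * Q ^ 3 / (16 * exp 1 * ψ * (2 * τ * ψ * Q') ^ 2 * Φ * τ ^ 2 * ι₁ ^ 2 + A * Q ^ 3))))))) * Real.log 4 / (2 * B * P.Klam + 1) →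
      (∀ k, 1 ≤ k → k ≤ Kb → Zk k) ∧
      (∀ k, 2 ≤ k → k ≤ Kb → ∀ (t : Fin 5) (p : ℕ), 3 ≤ p → p ≤ D →
        klTowerBLevF L M β U μ K d t k p ≤ A * (B * epsCoupling P U j) ^ (p - 1) * Q ^ p) ∧
      (∀ k, 1 ≤ k → k ≤ Kb →
        (∀ m, 4 ≤ m → m ≤ D → W * Z ^ m * klTowerMuLevF L M β U μ K d k m ≤ A' * (B * epsCoupling P U j) ^ (m - 1) * Q' ^ m) ∧
        (3 ≤ D → W * Z ^ 3 * klTowerMuLevF L M β U μ K d k 3 ≤ ι₃ * (B * epsCoupling P U j) ^ 2)) ∧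
      (4 * σ * (B * epsCoupling P U j) * Q' < 1 ∧ 2 * (B * epsCoupling P U j) * τ * Q' ≤ 1 ∧ exp 1 * τ * (B * epsCoupling P U j) * Q' < 1 ∧
        Φ * (τ * (ι₁ * (B * epsCoupling P U j) + ι₂ / (2 * Q') + ι₃ / (4 * Q' ^ 2) + A' * Q' / 4)) < 1 ∧
        Φ * (exp 1 * τ * (ι₁ * (B * epsCoupling P U j)) + (exp 1 * τ) ^ 2 * (ι₂ * (B * epsCoupling P U j)) + (exp 1 * τ) ^ 3 * (ι₃ * (B * epsCoupling P U j) ^ 2) +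
          A' * (exp 1 * τ * Q') * ((exp 1 * τ * (B * epsCoupling P U j) * Q') ^ 3 / (1 - exp 1 * τ * (B * epsCoupling P U j) * Q'))) < 1) := by
  obtain ⟨C₁, C₂, hC₁, hC₂, h⟩ := klTowerBLevF_le_law_of_base_rows_tokX
  refine ⟨C₁, C₂, hC₁, hC₂, fun R hR2 => ?_⟩
  obtain ⟨c₃, hc₃, U₀, hU₀, h'⟩ := h R hR2
  refine ⟨c₃, hc₃, U₀, hU₀, ?_⟩
  intro P c hP hc hc6 hc₃' μ hμ U hU hU9 hU₀' β hβmin hβc K hK L M _ _ hL3 hM3 d Kb D hd hKbN hD cc n j hreg hj B Ab Qb hB hAb hQb Nb hNb0 hcar hlawb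
    W Z σ Φ ψ τ ι₁ ι₂ X hW hZ hσ hΦ hψ hτ hι₁ hι₂ hX ρ Q' Q κ Y A A' ι₃ hρ hQ' hQ hκ hY hA hA' hι₃ hblock amp1 amp2 himp₁ himp₂ hcell Zk hZ1 hZsucc hstep hUdoor hcdoor
  have hβ : 0 < β := KLRegimeSplit.pos_of_klBetaMin_le hβmin
  have hK1 : 1 ≤ P.Klam := hP.1
  have hK0 : 0 ≤ P.Klam := le_trans zero_le_one hK1
  have hε : 0 < epsCoupling P U j := by
    unfold epsCoupling
    have : 0 < |U| + U ^ 2 * (j : ℝ) := by positivity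
    positivity
  set lam : ℝ := B * epsCoupling P U j with hlamdef
  have hlam : 0 < lam := by positivity
  -- the generic (I5) rows
  have hκ0 : 0 < κ := by rw [hκ]; positivity
  have ha₁ : 0 < W * (27 : ℝ) ^ 5 * Ab := by positivity
  have hr1 : ((2 : ℝ) ^ d)⁻¹ < 1 := inv_lt_one_of_one_lt₀ (one_lt_pow₀ (by norm_num) (by omega))
  have hκQ : 0 ≤ C₂ ^ 2 * ((2 : ℝ) ^ (d - 1))⁻¹ := by positivity
  have hQ'' : Q' = Z * Qb + 0 + 1 := by rw [hQ', add_zero]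
  have ha : W * (27 : ℝ) ^ 5 * Ab + κ * Ab = W * (27 : ℝ) ^ 5 * Ab + κ * Ab := rfl
  have h2d : (0 : ℝ) < (2 : ℝ) ^ (d - 1) := by positivity
  have hblock' : max 1 Z * (C₂ ^ 2 * ((2 : ℝ) ^ (d - 1))⁻¹) * max 4 (2 * τ * ψ) ≤ 1 := by
    rw [show max 1 Z * (C₂ ^ 2 * ((2 : ℝ) ^ (d - 1))⁻¹) * max 4 (2 * τ * ψ) = max 1 Z * C₂ ^ 2 * max 4 (2 * τ * ψ) / (2 : ℝ) ^ (d - 1) by ring,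
      div_le_one h2d]
    exact hblock
  obtain ⟨⟨hQ'0, hQ0, hA0, _, _, _⟩, ⟨hF1, hF2, hF3, hF4, _, hF6, hF7⟩, ⟨hu₁, hu₂⟩, _, _⟩ :=
    towerLevNumericsG_rows hW hZ hκ0 hκQ hr1 hQb ha₁ hAb.le le_rfl hι₂ hX hρ hQ'' hQ ha hY hA hA' hι₃ hblock' amp1 amp2
  obtain ⟨hx₁, hx₂, hx₃, hy, hθ, hclose⟩ :=
    towerLevNumericsG_side_of_doors hK0 hσ hΦ hψ hτ hW hZ hκ0 hκQ hr1 hQb ha₁ hAb.le le_rfl hι₁ hι₂ hX hB.le hU.le hreg hj hρ hQ'' hQ ha hY hA hA' hι₃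
      hblock' amp1 amp2 hUdoor hcdoor
  -- the two floors in p4's literal shape
  have hA'1 : W * ((27 : ℝ) ^ 5 * (C₁ / C₂) * (8 : ℝ) ^ (d - 1) * (Ab + A / (1 - ((2 : ℝ) ^ d)⁻¹))) ≤ A' := by
    calc W * ((27 : ℝ) ^ 5 * (C₁ / C₂) * (8 : ℝ) ^ (d - 1) * (Ab + A / (1 - ((2 : ℝ) ^ d)⁻¹)))
        = κ * (Ab + A / (1 - ((2 : ℝ) ^ d)⁻¹)) := by rw [hκ]; ring
      _ ≤ A' := hF2
  have hQ'1 : Z * (C₂ ^ 2 * ((2 : ℝ) ^ (d - 1))⁻¹ * max Q Qb) ≤ Q' := by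
    calc Z * (C₂ ^ 2 * ((2 : ℝ) ^ (d - 1))⁻¹ * max Q Qb) = Z * (C₂ ^ 2 * ((2 : ℝ) ^ (d - 1))⁻¹) * max Q Qb := by ring
      _ ≤ Q' := hF4
  -- the block-1 profile from the base datum
  have hZQb : ∀ m : ℕ, (Z * Qb) ^ m ≤ Q' ^ m := fun m => pow_le_pow_left₀ (by positivity) hF3 m
  have hμ1 : ∀ m, 3 ≤ m → W * Z ^ m * klTowerMuLevF L M β U μ K d 1 m ≤ (W * (27 : ℝ) ^ 5 * Ab) * lam ^ (m - 1) * (Z * Qb) ^ m := by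
    intro m hm
    calc W * Z ^ m * klTowerMuLevF L M β U μ K d 1 m ≤ W * Z ^ m * ((27 : ℝ) ^ 5 * Ab * lam ^ (m - 1) * Qb ^ m) :=
          mul_le_mul_of_nonneg_left (klTowerMuLevF_one_le_of_baseRows hβ U μ K d hlam.le hAb.le hQb Nb hNb0 hcar hlawb hm) (by positivity)
      _ = (W * (27 : ℝ) ^ 5 * Ab) * lam ^ (m - 1) * (Z * Qb) ^ m := by rw [mul_pow]; ring
  have hbase : ∀ m, 4 ≤ m → m ≤ D → W * Z ^ m * klTowerMuLevF L M β U μ K d 1 m ≤ A' * lam ^ (m - 1) * Q' ^ m := by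
    intro m hm _
    refine (hμ1 m (by omega)).trans ?_
    exact mul_le_mul (mul_le_mul_of_nonneg_right hF1 (pow_nonneg hlam.le _)) (hZQb m) (by positivity) (by positivity)
  have hbase3 : 3 ≤ D → W * Z ^ 3 * klTowerMuLevF L M β U μ K d 1 3 ≤ ι₃ * lam ^ 2 := by
    intro _
    refine (hμ1 3 le_rfl).trans ?_
    calc (W * (27 : ℝ) ^ 5 * Ab) * lam ^ (3 - 1) * (Z * Qb) ^ 3 = ((W * (27 : ℝ) ^ 5 * Ab) * (Z * Qb) ^ 3) * lam ^ 2 := by norm_num; ring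
      _ ≤ (A' * Q' ^ 3) * lam ^ 2 :=
          mul_le_mul_of_nonneg_right (mul_le_mul hF1 (hZQb 3) (by positivity) (by positivity)) (sq_nonneg _)
      _ ≤ ι₃ * lam ^ 2 := mul_le_mul_of_nonneg_right hF7 (sq_nonneg _)
  obtain ⟨hZt, hlaw, hrows⟩ := h' P c hP hc hc6 hc₃' μ hμ U hU hU9 hU₀' β hβmin hβc K hK L M hL3 hM3 d Kb D hd hKbN hD A lam Q Ab Qb hA0.le hlam hQ0
    hAb.le hQb Nb hNb0 hcar hlawb W Z A' Q' hW hZ hA'1 hQ'1 hQ'0 σ Φ ψ τ ι₁ ι₂ ι₃ X hσ hΦ hψ hτ hF6 hF7 hbase hbase3 himp₁ himp₂ hcell Zk hZ1 hZsucc hstep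
    hx₁ hx₂ hx₃ hy hθ hu₁ hu₂ hclose
  exact ⟨hZt, hlaw, hrows, hx₁, hx₂, hx₃, hy, hθ⟩

/-! ## §2 M4: amplitude rows by `B ≥ B₀`, token carried, Chernoff data exported -/

/-- **THE FLOOR-KEYED LAW WITH THE AMPLITUDE ROWS BY `B ≥ B₀`, TOKEN CARRIED, CHERNOFF DATA EXPORTED** («(ℓ)-READOUT-F» twin of
`klTowerBLevF_le_law_lev_of_doors_of_le_B_tok`: cell up to `k ≤ K_b`; conclusion enlarged by the per-block profile rows and the five smallness rows, in the
B-discounted data `ι₂′`). [cite: BenfattoGiulianiMastropietro2006, §2.8 (2.83), (2.93)-(2.98)] -/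
theorem klTowerBLevF_le_law_lev_of_doors_of_le_B_tokX :
    ∃ C₁ C₂ : ℝ, 0 < C₁ ∧ 0 < C₂ ∧ ∀ R : RenConsts, R.WF2 → ∃ c₃' : ℝ, 0 < c₃' ∧ ∃ U₀' : ℝ, 0 < U₀' ∧
      ∀ (P : SplitConsts) (c : ℝ), P.WF → 0 < c → c ≤ klEngC₃6 P R → c ≤ c₃' →
      ∀ μ ∈ klWindowC, ∀ U : ℝ, 0 < U → U ≤ klEngU₀9 P R c → U ≤ U₀' → ∀ β : ℝ, klBetaMin ≤ β → β ≤ Real.exp (c / U ^ 2) →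
      ∀ K : TrigPolyC4v, FrameOK R U (nScales β) μ K → ∀ (L M : ℕ) [NeZero L] [NeZero M],
      klEngL₃ β U ≤ L → klEngM₃ β U L ≤ M → ∀ d Kb D : ℕ, 2 ≤ d → d * Kb - 1 ≤ nScales β + 1 → 3 ≤ D →
      ∀ (cc : ℝ) (n j : ℕ), IsKLRegime U cc (-(n : ℤ)) → j ≤ n →
      ∀ (B Ab Qb ι₂ X : ℝ), 1 ≤ B → 0 < Ab → 0 ≤ Qb → 0 ≤ ι₂ → 0 ≤ X →
      -- the B-discounted data (equational binders)
      ∀ (Ab' ι₂' X' : ℝ), Ab' = Ab / B ^ 2 → ι₂' = ι₂ / B → X' = X / B ^ 2 →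
      -- the base datum at the family `F_{d−1}` and its unit law in the discounted shape, at `λ = B·ε_j`
      ∀ Nb : Fin 5 → ℕ → ℝ, (∀ t p, 0 ≤ Nb t p) →
        (∀ (t : Fin 5) (p : ℕ) (Ωe' : Fin (2 * p) → Option (SectorLeg (sectorCount (d - 1)))), levelCount Ωe' = (t : ℕ) + 1 →
          klLevNormOf L M β μ K (d - 1) (2 * p) (klTowerInput L M β U μ K d 1) Ωe' ≤ Nb t p) →
        (∀ (t : Fin 5) (p : ℕ), 3 ≤ p → Nb t p / klLevUnitF β M t p (d - 1) ≤ Ab' * (B * epsCoupling P U j) ^ (p - 1) * Qb ^ p) →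
      ∀ (W Z σ Φ ψ τ ι₁ : ℝ), 0 < W → 0 < Z → 0 ≤ σ → 0 ≤ Φ → 0 ≤ ψ → 0 < τ → 0 ≤ ι₁ →
      -- the explicit (I5)-F choices (equational binders) and the B-free `Ȳ`
      ∀ (ρ Q' Q κ Yb Y A A' ι₃ : ℝ), ρ = max 4 (2 * τ * ψ) → Q' = Z * Qb + 1 → Q = ρ * Q' →
        κ = W * ((27 : ℝ) ^ 5 * (C₁ / C₂) * (8 : ℝ) ^ (d - 1)) →
        Yb = ι₂ / (2 * Q') + W * Z ^ 3 * X / (4 * Q' ^ 2) + (W * (27 : ℝ) ^ 5 * Ab + κ * Ab) * Q' / 2 →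
        Y = ι₂' / (2 * Q') + W * Z ^ 3 * X' / (4 * Q' ^ 2) + (W * (27 : ℝ) ^ 5 * Ab' + κ * Ab') * Q' / 2 →
        A = 2 * Y * (1 - ((2 : ℝ) ^ d)⁻¹) / (κ * Q') →
        A' = (W * (27 : ℝ) ^ 5 * Ab' + κ * Ab') + 2 * Y / Q' → ι₃ = W * Z ^ 3 * X' + A' * Q' ^ 3 →
      -- the BLOCKING row (choice of `d`) and `B ≥ B₀` (the two amplitude rows)
      max 1 Z * C₂ ^ 2 * max 4 (2 * τ * ψ) ≤ (2 : ℝ) ^ (d - 1) →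
      max 1 (max (8 * Φ * τ * Yb) (128 * exp 1 * ψ ^ 3 * τ ^ 4 * Φ * κ * Yb / ((1 - ((2 : ℝ) ^ d)⁻¹) * ρ ^ 3))) ≤ B →
      -- the imports (E1 (I4)) and the located cell, in the discounted shapes, at `λ = B·ε_j`
      (∀ k, 1 ≤ k → k < Kb → W * Z ^ 1 * klTowerMuLevF L M β U μ K d k 1 ≤ ι₁ * (B * epsCoupling P U j)) →
      (∀ k, 1 ≤ k → k < Kb → W * Z ^ 2 * klTowerMuLevF L M β U μ K d k 2 ≤ ι₂' * (B * epsCoupling P U j)) →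
      (∀ k, 2 ≤ k → k ≤ Kb → klTowerMuLevAtF L M β U μ K d 0 k 3 ≤ X' * (B * epsCoupling P U j) ^ 2) →
      -- the token along the blocks («(ℓ)-Z-THREAD»): base, and propagation under the step's guard
      ∀ Zk : ℕ → Prop, Zk 1 →
      (∀ k, 1 ≤ k → k < Kb → Zk k → Φ * towerV D τ (fun m => W * Z ^ m * klTowerMuLevF L M β U μ K d k m) < 1 → Zk (k + 1)) →
      -- the floor step at blocks `k ≥ 1`, which may use the token at its own block
      (∀ t : Fin 5, ∀ k, 1 ≤ k → k < Kb → Zk k → ∀ N : ℕ, 2 ≤ N → ∀ p, 3 ≤ p → p ≤ D →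
        Φ * towerV D τ (fun m => W * Z ^ m * klTowerMuLevF L M β U μ K d k m) < 1 →
        klTowerBLevF L M β U μ K d t (k + 1) p ≤
          towerFO D σ (fun m => W * Z ^ m * klTowerMuLevF L M β U μ K d k m) p +
            ∑ n ∈ Icc 2 N, exp 1 * Φ ^ (n - 1) * ψ ^ p * towerS D τ (fun m => W * Z ^ m * klTowerMuLevF L M β U μ K d k m) n p +
            ψ ^ p * exp 1 * towerV D τ (fun m => W * Z ^ m * klTowerMuLevF L M β U μ K d k m) *
              (Φ * towerV D τ (fun m => W * Z ^ m * klTowerMuLevF L M β U μ K d k m)) ^ N /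
              (1 - Φ * towerV D τ (fun m => W * Z ^ m * klTowerMuLevF L M β U μ K d k m))) →
      -- the two doors
      U ≤ min 1 (min (1 / (8 * σ * Q' + 1)) (min (1 / (2 * exp 1 * τ * Q' + 1)) (min (1 / (4 * Φ * τ * ι₁ + 1))
        (min (1 / (2 * (Φ * (exp 1 * τ * ι₁ + (exp 1 * τ) ^ 2 * ι₂' + (exp 1 * τ) ^ 3 * ι₃ + A' * (exp 1 * τ * Q') ^ 2 / 2)) + 1))
          (min (A * Q ^ 3 / (16 * σ * Q' * A' * (4 * Q') ^ 3 + A * Q ^ 3))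
            (A * Q ^ 3 / (16 * exp 1 * ψ * (2 * τ * ψ * Q') ^ 2 * Φ * τ ^ 2 * ι₁ ^ 2 + A * Q ^ 3))))))) / (2 * B * P.Klam + 1) →
      cc ≤ min 1 (min (1 / (8 * σ * Q' + 1)) (min (1 / (2 * exp 1 * τ * Q' + 1)) (min (1 / (4 * Φ * τ * ι₁ + 1))
        (min (1 / (2 * (Φ * (exp 1 * τ * ι₁ + (exp 1 * τ) ^ 2 * ι₂' + (exp 1 * τ) ^ 3 * ι₃ + A' * (exp 1 * τ * Q') ^ 2 / 2)) + 1))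
          (min (A * Q ^ 3 / (16 * σ * Q' * A' * (4 * Q') ^ 3 + A * Q ^ 3))
            (A * Q ^ 3 / (16 * exp 1 * ψ * (2 * τ * ψ * Q') ^ 2 * Φ * τ ^ 2 * ι₁ ^ 2 + A * Q ^ 3))))))) * Real.log 4 / (2 * B * P.Klam + 1) →
      (∀ k, 1 ≤ k → k ≤ Kb → Zk k) ∧
      (∀ k, 2 ≤ k → k ≤ Kb → ∀ (t : Fin 5) (p : ℕ), 3 ≤ p → p ≤ D →
        klTowerBLevF L M β U μ K d t k p ≤ A * (B * epsCoupling P U j) ^ (p - 1) * Q ^ p) ∧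
      (∀ k, 1 ≤ k → k ≤ Kb →
        (∀ m, 4 ≤ m → m ≤ D → W * Z ^ m * klTowerMuLevF L M β U μ K d k m ≤ A' * (B * epsCoupling P U j) ^ (m - 1) * Q' ^ m) ∧
        (3 ≤ D → W * Z ^ 3 * klTowerMuLevF L M β U μ K d k 3 ≤ ι₃ * (B * epsCoupling P U j) ^ 2)) ∧
      (4 * σ * (B * epsCoupling P U j) * Q' < 1 ∧ 2 * (B * epsCoupling P U j) * τ * Q' ≤ 1 ∧ exp 1 * τ * (B * epsCoupling P U j) * Q' < 1 ∧
        Φ * (τ * (ι₁ * (B * epsCoupling P U j) + ι₂' / (2 * Q') + ι₃ / (4 * Q' ^ 2) + A' * Q' / 4)) < 1 ∧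
        Φ * (exp 1 * τ * (ι₁ * (B * epsCoupling P U j)) + (exp 1 * τ) ^ 2 * (ι₂' * (B * epsCoupling P U j)) + (exp 1 * τ) ^ 3 * (ι₃ * (B * epsCoupling P U j) ^ 2) +
          A' * (exp 1 * τ * Q') * ((exp 1 * τ * (B * epsCoupling P U j) * Q') ^ 3 / (1 - exp 1 * τ * (B * epsCoupling P U j) * Q'))) < 1) := by
  obtain ⟨C₁, C₂, hC₁, hC₂, h⟩ := klTowerBLevF_le_law_lev_of_doors_tokX
  refine ⟨C₁, C₂, hC₁, hC₂, fun R hR2 => ?_⟩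
  obtain ⟨c₃, hc₃, U₀, hU₀, h'⟩ := h R hR2
  refine ⟨c₃, hc₃, U₀, hU₀, ?_⟩
  intro P c hP hc hc6 hc₃' μ hμ U hU hU9 hU₀' β hβmin hβc K hK L M _ _ hL3 hM3 d Kb D hd hKbN hD cc n j hreg hj B Ab Qb ι₂ X hB hAb hQb hι₂ hX
    Ab' ι₂' X' hAb' hι₂' hX' Nb hNb0 hcar hlawb W Z σ Φ ψ τ ι₁ hW hZ hσ hΦ hψ hτ hι₁ ρ Q' Q κ Yb Y A A' ι₃ hρ hQ' hQ hκ hYb hY hA hA' hι₃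
    hblock hBle himp₁ himp₂ hcell Zk hZ1 hZsucc hstep hUdoor hcdoor
  have hB0 : 0 < B := lt_of_lt_of_le one_pos hB
  have hAb'0 : 0 < Ab' := by rw [hAb']; positivity
  have hι₂'0 : 0 ≤ ι₂' := by rw [hι₂']; positivity
  have hX'0 : 0 ≤ X' := by rw [hX']; positivity
  -- the two amplitude rows from `B ≥ B₀`
  have hκ0 : 0 ≤ κ := by rw [hκ]; positivity
  have hr1 : ((2 : ℝ) ^ d)⁻¹ < 1 := inv_lt_one_of_one_lt₀ (one_lt_pow₀ (by norm_num) (by omega))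
  have hρ0 : 0 < ρ := by rw [hρ]; exact lt_of_lt_of_le (by norm_num) (le_max_left _ _)
  have hQ'0 : 0 < Q' := by rw [hQ']; positivity
  have ha₁ : W * (27 : ℝ) ^ 5 * Ab' = W * (27 : ℝ) ^ 5 * Ab / B ^ 2 := by rw [hAb']; ring
  obtain ⟨amp1, amp2⟩ := towerLevNumericsG_amp_of_le_B (κA := κ) (r := ((2 : ℝ) ^ d)⁻¹) (a := W * (27 : ℝ) ^ 5 * Ab' + κ * Ab')
    (ab := W * (27 : ℝ) ^ 5 * Ab + κ * Ab) hΦ hψ hτ hW hZ hκ0 hr1 hρ0 hι₂ hX (by positivity : 0 ≤ W * (27 : ℝ) ^ 5 * Ab) hAb.le hQ'0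
    hι₂' hX' ha₁ hAb' rfl rfl hY hYb hBle
  exact h' P c hP hc hc6 hc₃' μ hμ U hU hU9 hU₀' β hβmin hβc K hK L M hL3 hM3 d Kb D hd hKbN hD cc n j hreg hj B Ab' Qb hB0 hAb'0 hQb Nb hNb0 hcar hlawb
    W Z σ Φ ψ τ ι₁ ι₂' X' hW hZ hσ hΦ hψ hτ hι₁ hι₂'0 hX'0 ρ Q' Q κ Y A A' ι₃ hρ hQ' hQ hκ hY hA hA' hι₃ hblock amp1 amp2 himp₁ himp₂ hcell Zk hZ1 hZsucc hstep
    hUdoor hcdoor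

end Summit.HubbardSuperconductivity.HubbardSuperconductivity.Theorems.EngineV8

end
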